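import Summits.QuantumAdvantage.QuantumAdvantage.Theorems.CubicForrelationNearExactIsExactTwelveTypeO768Wild2932
import Summits.QuantumAdvantage.QuantumAdvantage.Theorems.CubicForrelationNearExactIsExactTwelveLevelFiveHyperplaneGe2932
import Summits.QuantumAdvantage.QuantumAdvantage.Theorems.CubicForrelationNearExactIsExactTwelveTypeO934Wild

/-!
# Crux `CubicForrelation.NearExactIsExact` (stmt-QuantumAdvantage-14043) — n = 12: NO type-O side with base set `768` at `Φ ≥ 29/32`
  (the rigid `128` wild points `v = (−1)^{d₁}·1_S` give `v̂(c₁) = ±128`, incompatible with every partner type)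

Certificate seat `b2b-cforr-cert` (gen 22).  HONEST FRAMING: a kernel-checked theorem (standard axioms, no `decide`) about cubic Boolean pairs on
12 bits — the base-`768` configuration of the boundary rung `29/32` is DEAD for every partner type (HOME/b2b-cforr-cert-g22/PLAN-N12-928-EQ.md).
NO new value of `θ₁₂` by itself.  NOT summit progress.

* `to22_typeO_E768_ge2932_false`: by `to22_typeO_E768_ge2932_wild` the wild function is `v = (−1)^{d₁}` on a `128`-set `S` and `0` elsewhere, so
  `v̂(c₁) = (−1)^{b₁}·128`; the partner identity (`to18_typeO_partner_identity`) with `Ê ∈ 256ℤ` (`to15_char_sum_E`, gen 15) reads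
  `v̂(y)/8 = 4(−1)^g − 64s_b[y=c₁] + 16s_b·j(y) − u_f(y)`, `W_f = 16u_f`.  (a) `f` type O: `v̂(c₁)/8 = ±16` would be odd.  (b) `f` level 5
  (`u_f = 2u'`, `u'` odd on `2048` points, `tw22_oddset_card_ge2932`): `v̂/16` is odd there, so `Σ v̂² ≥ 2048·256 = 4096·Σv²` is tight:
  `v̂ = 0` off the odd set and `|v̂| = 16` on it — but `|v̂(c₁)| = 128`.  (c) `f` level `≥ 6` (`u_f = 4w`): `v̂/32` is odd exactly on the even set
  `Z_f` of `w` (`≥ 512` points unless `f` is bent, `tw_bent_end`), so `Σ v̂² ≥ 512·1024 = 4096·Σv²` is tight: `|v̂| ∈ {0, 32}` everywhere — but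
  `|v̂(c₁)| = 128`.

References: J. Ax (1964) / R. J. McEliece (1972); O. S. Rothaus (1976); Kasami–Tokura (1970); MacWilliams–Sloane (1977) Ch. 13–15; Carlet (2021)
§5.2.  Axioms: the standard three.
-/

set_option linter.dupNamespace false -- D-0017: single-problem summit ⇒ `QuantumAdvantage.QuantumAdvantage` by design

noncomputable section

namespace Summit.QuantumAdvantage.QuantumAdvantage.Theorems.CubicForrelation.NearExactIsExact

open Finset
open Literature.Computability.QuantumComplexity
open Literature.Computability.QuantumComplexity.BuzetChailloux (bxor zeroVec bxor_bxor_cancel_left bxor_zeroVec zeroVec_bxor bxor_comm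
  bxor_self twist_zeroVec_right twist_bxor_right)
open Literature.Computability.QuantumComplexity.DerivativeWalsh (W sum_W_sq)
open Literature.Computability.QuantumComplexity.Simon (twist_eq_one_or twist_mul_self)
open Summit.QuantumAdvantage.QuantumAdvantage.Theorems.NearExactIsExact.Negative (TypeOTwelve.typeO_of_exists_odd)

/-- **No type-O side with base set `768` at `Φ ≥ 29/32`** (12 bits).  See the module docstring.  Finite-slice statement, NOT summit
progress. [this work] -/
theorem to22_typeO_E768_ge2932_false (f g : (Fin (6 + 6) → Bool) → Bool) (hf : IsDegLeFun 3 f) (hg : IsDegLeFun 3 g)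
    (u : (Fin (6 + 6) → Bool) → ℤ) (hu : ∀ x, W (fun y => signOf (g y)) x = (2 : ℝ) ^ 4 * (u x : ℝ))
    (hodd : ∃ x, Odd (u x)) (hE : #(univ.filter fun x : Fin (6 + 6) → Bool => (Odd (u x / 2) ↔ Odd (u x / 2 / 2))) = 768)
    (hΦ : (29 / 32 : ℝ) ≤ forrelation f g) : False := by
  classical
  have hΦ' : forrelation g f = forrelation f g := by
    rw [Summit.QuantumAdvantage.QuantumAdvantage.Theorems.SignedCubicForrelationNotPrBPP.Negative.HalfQuad.forrelation_comm]
  obtain ⟨hΦeq, v, hv, hvval, hcard⟩ := to22_typeO_E768_ge2932_wild f g hf hg u hu hodd hE hΦ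
  have hlo' : (29 / 32 : ℝ) ≤ forrelation g f := by rw [hΦ']; exact hΦ
  have hall : ∀ x, Odd (u x) := TypeOTwelve.typeO_of_exists_odd g u hg hu hodd
  have hu' : ∀ x, W (fun y => signOf (g y)) x = (2 : ℝ) ^ (2 * 2) * (u x : ℝ) := fun x => (hu x).trans (by norm_num)
  have hd1 : IsDegLeFun 1 (fun x => decide (Odd (u x / 2))) := z2_digitOne 2 g u hg hu' hall
  have hd2 : IsDegLeFun 3 (fun x => decide (Odd (u x / 2 / 2))) := z2_digitTwo 2 g u hg hu' hall
  obtain ⟨c₁, b₁, hcb⟩ := stub_affineForm (6 + 6) _ hd1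
  set E := univ.filter (fun x : Fin (6 + 6) → Bool => (Odd (u x / 2) ↔ Odd (u x / 2 / 2))) with hEdef
  have hdegE : IsDegLeFun (2 + 1) (fun x => (decide (Odd (u x / 2)) ^^ decide (Odd (u x / 2 / 2))) ^^ true) :=
    tb_isDegLeFun_xor_const (bb_isDegLeFun_bxor (hd1.mono (by norm_num)) hd2) true
  have hsetE : (univ.filter fun x : Fin (6 + 6) → Bool =>
      ((decide (Odd (u x / 2)) ^^ decide (Odd (u x / 2 / 2))) ^^ true) = true) = E := by
    rw [hEdef]
    apply filter_congr
    intro x _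
    by_cases h1 : Odd (u x / 2) <;> by_cases h2 : Odd (u x / 2 / 2) <;> simp [h1, h2]
  -- the wild set `S`, `v = (−1)^{d₁}` on it, `#S = 128`, `Σ v² = 128`
  set S := univ.filter (fun x : Fin (6 + 6) → Bool => v x ≠ 0) with hSdef
  have hvS : ∀ x, v x ≠ 0 → (v x = 1 ∨ v x = -1) ∧ (v x : ℝ) = signOf b₁ * twist c₁ x := by
    intro x hx
    rcases hvval x with h0 | ⟨h1, hτ⟩
    · exact absurd h0 hx
    refine ⟨h1, ?_⟩
    have hvd : v x = sZ (decide (Odd (u x / 2))) := by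
      rcases tp_sZ_cases (decide (Odd (u x / 2))) with hs | hs <;> rw [hs] at hτ ⊢ <;> split_ifs at hτ <;> omega
    rw [hvd, tp_sZ_cast, hcb x]
  have hv2 : (∑ x, v x ^ 2 : ℤ) = 128 := by
    have h1 : (∑ x, v x ^ 2 : ℤ) = ∑ x, (if v x ≠ 0 then 1 else 0 : ℤ) := by
      refine sum_congr rfl fun x _ => ?_
      by_cases hx : v x ≠ 0
      · rw [if_pos hx]; rcases (hvS x hx).1 with h | h <;> rw [h] <;> norm_num
      · push Not at hx; rw [if_neg (by simpa using hx), hx]; norm_num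
    rw [h1, sum_boole]
    exact_mod_cast hcard
  -- `v̂`, Parseval, and `v̂(c₁) = ±128`
  set Vh : (Fin (6 + 6) → Bool) → ℝ := fun y => ∑ x, (v x : ℝ) * twist x y with hVh
  have hParsV : ∑ y, Vh y ^ 2 = 524288 := by
    have h := sum_W_sq (n := 6 + 6) (fun x => (v x : ℝ))
    unfold W at h
    rw [h]
    have : ∑ x, ((v x : ℝ)) ^ 2 = 128 := by
      have h' : ((∑ x, v x ^ 2 : ℤ) : ℝ) = 128 := by exact_mod_cast hv2
      push_cast at h'; exact h'
    rw [this]; norm_num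
  have hVc : Vh c₁ = signOf b₁ * 128 := by
    simp only [Vh]
    rw [← sum_subset (subset_univ S) (fun x _ hx => by
      have : v x = 0 := by by_contra h; exact hx (mem_filter.2 ⟨mem_univ _, h⟩)
      rw [this]; simp)]
    rw [sum_congr rfl fun x hx => by rw [(hvS x (mem_filter.1 hx).2).2, twist_comm c₁ x, mul_assoc, twist_mul_self, mul_one],
      sum_const, nsmul_eq_mul, hcard, mul_comm]
    norm_num
  have hVc2 : Vh c₁ ^ 2 = 16384 := by
    rw [hVc, mul_pow]
    have hs1 : signOf b₁ ^ 2 = (1 : ℝ) := by cases b₁ <;> simp [signOf]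
    rw [hs1]; norm_num
  -- the partner identity with `Ê ∈ 256ℤ`
  obtain ⟨uf, huf⟩ := tw_base (n := 6 + 6) f hf 4 (by norm_num)
  have hid : ∀ y, ∃ j : ℤ, Vh y = 8 * (((4 * sZ (g y) - 64 * sZ b₁ * (if bxor c₁ y = (fun _ => false) then 1 else 0) +
      16 * sZ b₁ * j - uf y : ℤ) : ℝ)) := by
    intro y
    have h := to18_typeO_partner_identity f g u hu v hv c₁ b₁ hcb uf huf y
    rw [← hEdef] at h
    obtain ⟨j, hj⟩ := to15_char_sum_E _ hdegE (by rw [hsetE]; exact hE) (bxor c₁ y)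
    rw [hsetE] at hj
    rw [hj] at h
    refine ⟨j, ?_⟩
    have hsg := tp_sZ_cast (g y)
    have hsb := tp_sZ_cast b₁
    simp only [Vh]
    push_cast
    rw [hsg, hsb]
    split_ifs at h ⊢ with hz
    · norm_num at h ⊢; linarith
    · linarith
  -- a lower bound for `Σ Vh²` from a set carrying `Vh² ≥ c`, plus the centre
  have hlow : ∀ (T : Finset (Fin (6 + 6) → Bool)) (c : ℝ), 0 ≤ c → (∀ y ∈ T, c ≤ Vh y ^ 2) →
      c * ((#T : ℝ) - 1) + 16384 ≤ ∑ y, Vh y ^ 2 := by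
    intro T c hc hT
    have h1 : ∑ y ∈ T.erase c₁, c ≤ ∑ y ∈ T.erase c₁, Vh y ^ 2 := sum_le_sum fun y hy => hT y (mem_of_mem_erase hy)
    rw [sum_const, nsmul_eq_mul] at h1
    have h2 : ((#T : ℝ) - 1) ≤ (#(T.erase c₁) : ℝ) := by
      have := pred_card_le_card_erase (s := T) (a := c₁)
      have h' : ((#T - 1 : ℕ) : ℝ) ≤ (#(T.erase c₁) : ℝ) := by exact_mod_cast this
      rcases Nat.eq_zero_or_pos #T with h0 | hpos
      · rw [h0]; norm_num; linarith [Nat.cast_nonneg (α := ℝ) (#(T.erase c₁))]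
      · rw [Nat.cast_sub hpos] at h'; simpa using h'
    have h3 : ∑ y ∈ insert c₁ (T.erase c₁), Vh y ^ 2 ≤ ∑ y, Vh y ^ 2 :=
      sum_le_sum_of_subset_of_nonneg (subset_univ _) fun y _ _ => sq_nonneg _
    rw [sum_insert (notMem_erase c₁ T), hVc2] at h3
    nlinarith
  by_cases hO : ∃ y, Odd (uf y)
  · /- (a) type-O partner: `Vh(c₁)/8 = ±16` would be odd -/
    obtain ⟨y₁, hy₁⟩ := hO
    have hallf : ∀ y, Odd (uf y) := TypeOTwelve.typeO_of_exists_odd f uf hf huf ⟨y₁, hy₁⟩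
    obtain ⟨j, hj⟩ := hid c₁
    have hz : bxor c₁ c₁ = (fun _ => false) := by funext i; simp [bxor]
    rw [hVc, if_pos hz, ← tp_sZ_cast b₁] at hj
    have hZ : (sZ b₁ : ℤ) * 128 = 8 * (4 * sZ (g c₁) - 64 * sZ b₁ * 1 + 16 * sZ b₁ * j - uf c₁) := by exact_mod_cast hj
    have h0 := Int.odd_iff.1 (hallf c₁)
    rcases tp_sZ_cases b₁ with hs | hs <;> rw [hs] at hZ <;> omega
  push Not at hO
  have huf5 := tw_level_up (j := 4) f uf huf hO
  have hev2 : ∀ y, uf y = 2 * (uf y / 2) := fun y =>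
    (Int.mul_ediv_cancel' (even_iff_two_dvd.1 (Int.not_odd_iff_even.1 (hO y)))).symm
  by_cases hO5 : ∃ y, Odd (uf y / 2)
  · /- (b) level-5 partner: `Vh² ≥ 256` on the `2048`-point odd set -/
    have hcardP := tw22_oddset_card_ge2932 g f hf (fun y => uf y / 2) huf5 hO5 hlo'
    have h256 : ∀ y ∈ univ.filter (fun y : Fin (6 + 6) → Bool => Odd (uf y / 2)), (256 : ℝ) ≤ Vh y ^ 2 := by
      intro y hy
      have hyo : Odd (uf y / 2) := (mem_filter.1 hy).2
      obtain ⟨j, hj⟩ := hid y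
      set K : ℤ := 4 * sZ (g y) - 64 * sZ b₁ * (if bxor c₁ y = (fun _ => false) then 1 else 0) + 16 * sZ b₁ * j - uf y with hKdef
      have hK2 : K ≤ -2 ∨ 2 ≤ K := by
        have h0 := Int.odd_iff.1 hyo
        have h2 := hev2 y
        simp only [K]
        rcases tp_sZ_cases (g y) with hs | hs <;> rcases tp_sZ_cases b₁ with hs' | hs' <;> rw [hs, hs'] <;> split_ifs <;> omega
      have hK4 : (4 : ℝ) ≤ (K : ℝ) ^ 2 := by exact_mod_cast tp_sq_ge (k := 2) (by norm_num) hK2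
      rw [hj]; nlinarith
    have h := hlow _ 256 (by norm_num) h256
    rw [hcardP, hParsV] at h
    norm_num at h
  · /- (c) level ≥ 6 partner: `Vh² ≥ 1024` on the even set of `k = u_f/4`, `≥ 512` points -/
    push Not at hO5
    have huf6 := tw_level_up (j := 5) f (fun y => uf y / 2) huf5 hO5
    have hev4 : ∀ y, uf y / 2 = 2 * (uf y / 2 / 2) := fun y =>
      (Int.mul_ediv_cancel' (even_iff_two_dvd.1 (Int.not_odd_iff_even.1 (hO5 y)))).symm
    set k : (Fin (6 + 6) → Bool) → ℤ := fun y => uf y / 2 / 2 with hkdef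
    have hwf : ∀ y, W (fun x => signOf (f x)) y = (2 : ℝ) ^ 6 * (k y : ℝ) := fun y => huf6 y
    have huk : ∀ y, uf y = 4 * k y := fun y => by rw [hev2 y, hev4 y]; simp only [k]; ring
    have hnotbent : ∃ y, ¬ Odd (k y) := by
      by_contra hall'
      push Not at hall'
      set u4 : (Fin (6 + 6) → Bool) → ℤ := fun y => 4 * k y with hu4def
      have hu4 : ∀ y, W (fun x => signOf (f x)) y = (2 : ℝ) ^ 4 * (u4 y : ℝ) := by
        intro y; rw [hwf y]; simp only [u4]; push_cast; ring
      have hpar : ∑ y, k y ^ 2 = 4096 := by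
        have h := zms_sum_u_sq 2 f u4 (fun y => (hu4 y).trans (by norm_num))
        have e : ∑ y, ((u4 y : ℝ)) ^ 2 = 16 * ∑ y, ((k y : ℝ)) ^ 2 := by
          rw [mul_sum]; exact sum_congr rfl fun y _ => by simp only [u4]; push_cast; ring
        rw [e] at h
        norm_num at h
        have h' : ∑ y, ((k y : ℝ)) ^ 2 = 4096 := by linarith
        exact_mod_cast h'
      have hsq1' : ∀ y, k y ^ 2 = 1 := by
        have hge : ∀ y, (1 : ℤ) ≤ k y ^ 2 := fun y => by
          have h0 := Int.odd_iff.1 (hall' y)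
          have : k y ≤ -1 ∨ 1 ≤ k y := by omega
          have := tp_sq_ge (k := 1) (by norm_num) this
          linarith
        have hsum0 : ∑ y, (k y ^ 2 - 1 : ℤ) = 0 := by
          rw [sum_sub_distrib, hpar, sum_const, card_univ, Fintype.card_fun, Fintype.card_bool, Fintype.card_fin]; norm_num
        intro y
        have := (sum_eq_zero_iff_of_nonneg fun z _ => by have := hge z; linarith).1 hsum0 y (mem_univ y)
        linarith
      have hbent : ∀ y, W (fun x => signOf (f x)) y ^ 2 = (2 : ℝ) ^ (6 + 6) := by
        intro y
        rw [hwf y, mul_pow]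
        have : ((k y : ℝ)) ^ 2 = 1 := by exact_mod_cast hsq1' y
        rw [this]; norm_num
      rcases tw_bent_end (by norm_num) g f hg hf hbent with h | h
      · rw [hΦ', hΦeq] at h; norm_num at h
      · rw [hΦ', hΦeq] at h; norm_num at h
    obtain ⟨y₁, hy₁⟩ := hnotbent
    have hp : IsDegLeFun 3 (fun y => decide (Odd (k y))) :=
      stub_walshTower stub_axParity (6 + 6) 6 3 f k hf hwf (by intro j hj hjn; omega)
    have hp' : IsDegLeFun (2 + 1) (fun y => decide (Odd (k y)) ^^ true) := tb_isDegLeFun_xor_const hp true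
    set Zf := univ.filter (fun y : Fin (6 + 6) → Bool => (decide (Odd (k y)) ^^ true) = true) with hZfdef
    have hne : ∃ y, (decide (Odd (k y)) ^^ true) = true := ⟨y₁, by simpa using hy₁⟩
    have hRM := bb_rmWeight_holds (6 + 6) 3 (fun y => decide (Odd (k y)) ^^ true) hp' hne
    have hfold : (univ.filter fun y : Fin (6 + 6) → Bool => (decide (Odd (k y)) ^^ true) = true) = Zf := rfl
    rw [hfold] at hRM
    have hZge : 512 ≤ #Zf := by
      have : (2 : ℕ) ^ (6 + 6) = 4096 := by norm_num
      rw [this] at hRM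
      have : (2 : ℕ) ^ 3 = 8 := by norm_num
      rw [this] at hRM
      omega
    have h1024 : ∀ y ∈ Zf, (1024 : ℝ) ≤ Vh y ^ 2 := by
      intro y hy
      have hye : ¬ Odd (k y) := by have := (mem_filter.1 hy).2; simpa using this
      obtain ⟨j, hj⟩ := hid y
      set K : ℤ := 4 * sZ (g y) - 64 * sZ b₁ * (if bxor c₁ y = (fun _ => false) then 1 else 0) + 16 * sZ b₁ * j - uf y with hKdef
      have hK4 : K ≤ -4 ∨ 4 ≤ K := by
        obtain ⟨i, hi⟩ := Int.not_odd_iff_even.1 hye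
        have h2 := huk y
        simp only [K]
        rcases tp_sZ_cases (g y) with hs | hs <;> rcases tp_sZ_cases b₁ with hs' | hs' <;> rw [hs, hs'] <;> split_ifs <;> omega
      have hK16 : (16 : ℝ) ≤ (K : ℝ) ^ 2 := by exact_mod_cast tp_sq_ge (k := 4) (by norm_num) hK4
      rw [hj]; nlinarith
    have h := hlow _ 1024 (by norm_num) h1024
    rw [hParsV] at h
    have hZge' : (512 : ℝ) ≤ (#Zf : ℝ) := by exact_mod_cast hZge
    nlinarith

end Summit.QuantumAdvantage.QuantumAdvantage.Theorems.CubicForrelation.NearExactIsExact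

end
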